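import Mathlib
import Summits.AtomisticToContinuum.Crystallization.Theses.PhononSlackCertificates

/-!
# Route `PhononSlackCertificates`, crux `NearFieldConvexity` (stmt-AtomisticToContinuum-13958), line `Sketch`:
stub `stub_fluxEnvelope`

The FLUX ENVELOPE used by the bookkeeping of skeleton v9: for a `δ`-separated configuration `x`
(`δ > 0`) and DISJOINT finite sets `A`, `B` of particle indices,
`Σ_{i ∈ A} Σ_{j ∈ B} |x i − x j|⁻⁶ ≤ 250 · δ⁻⁶ · #B`.

Proof: swap the two sums (`Finset.sum_comm`); for each fixed `j ∈ B` the column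
`Σ_{i ∈ A} |x i − x j|⁻⁶` is, after `dist_comm`, a sub-sum (nonnegative terms, `A ⊆ univ.erase j`
because `A` and `B` are disjoint and `j ∈ B`) of the shell sum
`Σ_{k ≠ j} |x j − x k|⁻⁶ ≤ 250 · δ⁻⁶` (`sum_inv_pow_six_le` of
`Literature/MathematicalPhysics/StatisticalMechanics/LennardJonesClusters.lean`); summing the constant
bound over `j ∈ B` gives the claim.  Nothing about goodness / layering is used or stated here.
-/

noncomputable section

open scoped BigOperators
open Literature.MathematicalPhysics.StatisticalMechanics Literature.Geometry.DiscreteGeometry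

namespace Summit.AtomisticToContinuum.Crystallization.Theorems.PhononSlackNearFieldConvexity

/-- **Column bound.**  For a `δ`-separated configuration `x` (`δ > 0`), a particle `j` and a finite
set `A` of particles not containing `j`, `Σ_{i ∈ A} |x i − x j|⁻⁶ ≤ 250 · δ⁻⁶`: after `dist_comm` the
sum is a sub-sum, with nonnegative terms, of the shell sum `sum_inv_pow_six_le` at `j`. [folklore] -/
theorem column_sum_inv_pow_six_le {N : ℕ} (x : Fin N → EuclideanSpace ℝ (Fin 3)) {δ : ℝ}
    (hδ : 0 < δ) (hsep : ∀ i j : Fin N, i ≠ j → δ ≤ dist (x i) (x j)) {A : Finset (Fin N)}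
    {j : Fin N} (hjA : j ∉ A) :
    ∑ i ∈ A, (dist (x i) (x j))⁻¹ ^ 6 ≤ 250 * δ⁻¹ ^ 6 := by
  have hsub : A ⊆ Finset.univ.erase j := fun i hi =>
    Finset.mem_erase.2 ⟨fun h => hjA (h ▸ hi), Finset.mem_univ i⟩
  calc ∑ i ∈ A, (dist (x i) (x j))⁻¹ ^ 6 = ∑ i ∈ A, (dist (x j) (x i))⁻¹ ^ 6 :=
        Finset.sum_congr rfl fun i _ => by rw [dist_comm]
    _ ≤ ∑ k ∈ Finset.univ.erase j, (dist (x j) (x k))⁻¹ ^ 6 :=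
        Finset.sum_le_sum_of_subset_of_nonneg hsub fun k _ _ => by positivity
    _ ≤ 250 * δ⁻¹ ^ 6 := sum_inv_pow_six_le x hδ hsep j

/-- **Stub `stub_fluxEnvelope` (FLUX ENVELOPE).**  For a `δ`-separated configuration (`δ > 0`) and
disjoint finite sets `A`, `B` of particles,
`Σ_{i ∈ A} Σ_{j ∈ B} |x i − x j|⁻⁶ ≤ 250 · δ⁻⁶ · #B`
(swap the sums, `Finset.sum_comm`; the column bound `column_sum_inv_pow_six_le` at each `j ∈ B`,
which is not in `A` by disjointness; `Finset.sum_const`). [folklore] -/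
theorem stub_fluxEnvelope :
    ∀ (N : ℕ) (x : Fin N → EuclideanSpace ℝ (Fin 3)) (δ : ℝ), 0 < δ →
      (∀ i j : Fin N, i ≠ j → δ ≤ dist (x i) (x j)) →
      ∀ (A B : Finset (Fin N)), Disjoint A B →
        ∑ i ∈ A, ∑ j ∈ B, (dist (x i) (x j))⁻¹ ^ 6 ≤ 250 * δ⁻¹ ^ 6 * (B.card : ℝ) := by
  intro N x δ hδ hsep A B hAB
  rw [Finset.sum_comm]
  have hcol : ∀ j ∈ B, ∑ i ∈ A, (dist (x i) (x j))⁻¹ ^ 6 ≤ 250 * δ⁻¹ ^ 6 := fun j hj =>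
    column_sum_inv_pow_six_le x hδ hsep (Finset.disjoint_right.1 hAB hj)
  calc ∑ j ∈ B, ∑ i ∈ A, (dist (x i) (x j))⁻¹ ^ 6 ≤ ∑ _j ∈ B, (250 * δ⁻¹ ^ 6 : ℝ) :=
        Finset.sum_le_sum hcol
    _ = 250 * δ⁻¹ ^ 6 * (B.card : ℝ) := by
        rw [Finset.sum_const, nsmul_eq_mul, mul_comm]

end Summit.AtomisticToContinuum.Crystallization.Theorems.PhononSlackNearFieldConvexity
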